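import Mathlib
import HarnessLib

/-!
# Radiation profiles on the line: substitutions `u = t ∓ x`, vanishing tails, and the
# Minkowski / squeeze lemmas for energies in `ℝ≥0∞`

Topic `Literature/Analysis/ODE` (namespace `Literature.Analysis.ODE.Scattering1D`); Mathlib-only
toolkit (everything proved, no definitions) for the energy identities of radiation-field
representations (`RadiationField1DEnergy.lean`).  For a profile `G : ℝ → ℝ` the radiated energy
density of the mover it generates is `2G(t ∓ x)²`; here:

* `setLIntegral_profile_sub/_add` and the `Ioi/Iio/univ` forms — the substitutions
  `∫_{x>c} 2G(t−x)² dx = ∫_{u<t−c} 2G²`, `∫_{x<c} 2G(t+x)² dx = ∫_{v<t+c} 2G²`, … (Lebesgue measure is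
  invariant under `x ↦ t − x`, `x ↦ t + x`; lower integrals, no measurability needed);
* `lintegral_two_mul_sq_lt_top`, `tendsto_tail_two_mul_sq` — an `L²` profile radiates finite energy
  and its tails `∫_{u>c} 2G²` vanish as `c → +∞`;
* `aemeasurable_comp_sub/_add` — measurability of `x ↦ G(t ∓ x)`;
* `sqrt_sum_sq_add_le` — the triangle inequality of `ℝ³` written out;
* `lintegral_rpow_half_le_add` — the abstract Minkowski step: `√e ≤ √d + √p` pointwise gives
  `(∫e)^{1/2} ≤ (∫d)^{1/2} + (∫p)^{1/2}` (`ENNReal.lintegral_Lp_add_le`);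
* `tendsto_of_rpow_half_bounds` — the squeeze: two such bounds with `D → 0`, `P → L` force `E → L`.

Folklore throughout.
-/

noncomputable section

open Set Filter MeasureTheory
open scoped ENNReal Topology

namespace Literature.Analysis.ODE

namespace Scattering1D

/-! ### Substitutions `u = t − x`, `v = t + x` and vanishing tails -/

/-- `∫_{x ∈ (t − ·)⁻¹ s} 2G(t − x)² dx = ∫_{s} 2G²`. [folklore] -/
theorem setLIntegral_profile_sub (G : ℝ → ℝ) (t : ℝ) (s : Set ℝ) :
    ∫⁻ x in (fun x ↦ t - x) ⁻¹' s, ENNReal.ofReal (2 * G (t - x) ^ 2) = ∫⁻ u in s, ENNReal.ofReal (2 * G u ^ 2) :=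
  (Measure.measurePreserving_sub_left volume t).setLIntegral_comp_preimage_emb
    (MeasurableEquiv.subLeft t).measurableEmbedding (fun u ↦ ENNReal.ofReal (2 * G u ^ 2)) s

/-- `∫_{x ∈ (t + ·)⁻¹ s} 2G(t + x)² dx = ∫_{s} 2G²`. [folklore] -/
theorem setLIntegral_profile_add (G : ℝ → ℝ) (t : ℝ) (s : Set ℝ) :
    ∫⁻ x in (fun x ↦ t + x) ⁻¹' s, ENNReal.ofReal (2 * G (t + x) ^ 2) = ∫⁻ u in s, ENNReal.ofReal (2 * G u ^ 2) :=
  (measurePreserving_add_left volume t).setLIntegral_comp_preimage_emb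
    (MeasurableEquiv.addLeft t).measurableEmbedding (fun u ↦ ENNReal.ofReal (2 * G u ^ 2)) s

/-- `∫_{x > c} 2G(t − x)² dx = ∫_{u < t − c} 2G²`. [folklore] -/
theorem setLIntegral_Ioi_profile_sub (G : ℝ → ℝ) (t c : ℝ) :
    ∫⁻ x in Ioi c, ENNReal.ofReal (2 * G (t - x) ^ 2) =
      ∫⁻ u in Iio (t - c), ENNReal.ofReal (2 * G u ^ 2) := by
  have hs : (fun x ↦ t - x) ⁻¹' Iio (t - c) = Ioi c := by
    ext x
    simp only [mem_preimage, mem_Iio, mem_Ioi, sub_lt_sub_iff_left]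
  rw [← setLIntegral_profile_sub G t (Iio (t - c)), hs]

/-- `∫_{x < c} 2G(t − x)² dx = ∫_{u > t − c} 2G²`. [folklore] -/
theorem setLIntegral_Iio_profile_sub (G : ℝ → ℝ) (t c : ℝ) :
    ∫⁻ x in Iio c, ENNReal.ofReal (2 * G (t - x) ^ 2) =
      ∫⁻ u in Ioi (t - c), ENNReal.ofReal (2 * G u ^ 2) := by
  have hs : (fun x ↦ t - x) ⁻¹' Ioi (t - c) = Iio c := by
    ext x
    simp only [mem_preimage, mem_Iio, mem_Ioi, sub_lt_sub_iff_left]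
  rw [← setLIntegral_profile_sub G t (Ioi (t - c)), hs]

/-- `∫_{x > c} 2G(t + x)² dx = ∫_{v > t + c} 2G²`. [folklore] -/
theorem setLIntegral_Ioi_profile_add (G : ℝ → ℝ) (t c : ℝ) :
    ∫⁻ x in Ioi c, ENNReal.ofReal (2 * G (t + x) ^ 2) =
      ∫⁻ u in Ioi (t + c), ENNReal.ofReal (2 * G u ^ 2) := by
  have hs : (fun x ↦ t + x) ⁻¹' Ioi (t + c) = Ioi c := by
    ext x
    simp only [mem_preimage, mem_Ioi, add_lt_add_iff_left]
  rw [← setLIntegral_profile_add G t (Ioi (t + c)), hs]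

/-- `∫_{x < c} 2G(t + x)² dx = ∫_{v < t + c} 2G²`. [folklore] -/
theorem setLIntegral_Iio_profile_add (G : ℝ → ℝ) (t c : ℝ) :
    ∫⁻ x in Iio c, ENNReal.ofReal (2 * G (t + x) ^ 2) =
      ∫⁻ u in Iio (t + c), ENNReal.ofReal (2 * G u ^ 2) := by
  have hs : (fun x ↦ t + x) ⁻¹' Iio (t + c) = Iio c := by
    ext x
    simp only [mem_preimage, mem_Iio, add_lt_add_iff_left]
  rw [← setLIntegral_profile_add G t (Iio (t + c)), hs]

/-- `∫ 2G(t − x)² dx = ∫ 2G²`. [folklore] -/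
theorem lintegral_profile_sub (G : ℝ → ℝ) (t : ℝ) :
    ∫⁻ x, ENNReal.ofReal (2 * G (t - x) ^ 2) = ∫⁻ u, ENNReal.ofReal (2 * G u ^ 2) := by
  rw [← Measure.restrict_univ (μ := volume), ← setLIntegral_profile_sub G t univ, preimage_univ]

/-- `∫ 2G(t + x)² dx = ∫ 2G²`. [folklore] -/
theorem lintegral_profile_add (G : ℝ → ℝ) (t : ℝ) :
    ∫⁻ x, ENNReal.ofReal (2 * G (t + x) ^ 2) = ∫⁻ u, ENNReal.ofReal (2 * G u ^ 2) := by
  rw [← Measure.restrict_univ (μ := volume), ← setLIntegral_profile_add G t univ, preimage_univ]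

/-- **An `L²` profile radiates finite energy**: `∫_s 2G² ≤ 2‖G‖₂² < ∞`. [folklore] -/
theorem lintegral_two_mul_sq_lt_top {G : ℝ → ℝ} (hG : MemLp G 2) (s : Set ℝ) :
    ∫⁻ u in s, ENNReal.ofReal (2 * G u ^ 2) < ⊤ := by
  refine lt_of_le_of_lt (lintegral_mono_set (subset_univ s)) ?_
  rw [Measure.restrict_univ]
  have hint : Integrable (fun u ↦ G u ^ 2) := hG.integrable_sq
  have h2 : ∫⁻ u, ENNReal.ofReal (2 * G u ^ 2) = 2 * ∫⁻ u, ENNReal.ofReal (G u ^ 2) := by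
    rw [← lintegral_const_mul' _ _ ENNReal.ofNat_ne_top]
    refine lintegral_congr fun u ↦ ?_
    rw [ENNReal.ofReal_mul zero_le_two, ENNReal.ofReal_ofNat]
  rw [h2]
  exact ENNReal.mul_lt_top ENNReal.ofNat_lt_top
    ((hasFiniteIntegral_iff_ofReal (ae_of_all _ fun u ↦ sq_nonneg (G u))).1 hint.hasFiniteIntegral)

/-- **Tails of an `L²` profile vanish**: `∫_{u > c} 2G² → 0` as `c → +∞`. [folklore] -/
theorem tendsto_tail_two_mul_sq {G : ℝ → ℝ} (hG : MemLp G 2) :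
    Tendsto (fun c : ℝ ↦ ∫⁻ u in Ioi c, ENNReal.ofReal (2 * G u ^ 2)) atTop (𝓝 0) := by
  set ν : Measure ℝ := volume.withDensity fun u ↦ ENNReal.ofReal (2 * G u ^ 2) with hν
  have happ : ∀ c : ℝ, ∫⁻ u in Ioi c, ENNReal.ofReal (2 * G u ^ 2) = ν (Ioi c) := fun c ↦ by
    rw [hν, withDensity_apply _ measurableSet_Ioi]
  have hI : ⋂ c : ℝ, Ioi c = ∅ := by
    ext x
    simp only [mem_iInter, mem_Ioi, mem_empty_iff_false, iff_false, not_forall, not_lt]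
    exact ⟨x, le_rfl⟩
  have h := tendsto_measure_iInter_atTop (μ := ν) (s := fun c : ℝ ↦ Ioi c)
    (fun c ↦ measurableSet_Ioi.nullMeasurableSet) (fun a b hab ↦ Ioi_subset_Ioi hab)
    ⟨0, by rw [← happ]; exact (lintegral_two_mul_sq_lt_top hG _).ne⟩
  rw [hI, measure_empty] at h
  refine h.congr fun c ↦ ?_
  simp only [Function.comp_apply, happ]

/-- Tails along a divergent cut-off vanish. [folklore] -/
theorem tendsto_tail_two_mul_sq_comp {G : ℝ → ℝ} (hG : MemLp G 2) {c : ℝ → ℝ}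
    (hc : Tendsto c atTop atTop) :
    Tendsto (fun t ↦ ∫⁻ u in Ioi (c t), ENNReal.ofReal (2 * G u ^ 2)) atTop (𝓝 0) :=
  (tendsto_tail_two_mul_sq hG).comp hc

/-! ### Measurability -/

/-- An a.e.-strongly measurable profile read along `x ↦ t − x` is a.e.-measurable. [folklore] -/
theorem aemeasurable_comp_sub {G : ℝ → ℝ} (hG : AEStronglyMeasurable G volume) (t : ℝ) :
    AEMeasurable (fun x ↦ G (t - x)) volume :=
  hG.aemeasurable.comp_quasiMeasurePreserving
    (Measure.measurePreserving_sub_left volume t).quasiMeasurePreserving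

/-- An a.e.-strongly measurable profile read along `x ↦ t + x` is a.e.-measurable. [folklore] -/
theorem aemeasurable_comp_add {G : ℝ → ℝ} (hG : AEStronglyMeasurable G volume) (t : ℝ) :
    AEMeasurable (fun x ↦ G (t + x)) volume :=
  hG.aemeasurable.comp_quasiMeasurePreserving
    (measurePreserving_add_left volume t).quasiMeasurePreserving

/-! ### The pointwise triangle inequality in `ℝ³` -/

/-- `√((a₁+b₁)² + (a₂+b₂)² + (a₃+b₃)²) ≤ √(a₁²+a₂²+a₃²) + √(b₁²+b₂²+b₃²)` (the triangle inequality of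
`ℝ³`, from Cauchy–Schwarz for three terms). [folklore] -/
theorem sqrt_sum_sq_add_le (a₁ a₂ a₃ b₁ b₂ b₃ : ℝ) :
    Real.sqrt ((a₁ + b₁) ^ 2 + (a₂ + b₂) ^ 2 + (a₃ + b₃) ^ 2) ≤
      Real.sqrt (a₁ ^ 2 + a₂ ^ 2 + a₃ ^ 2) + Real.sqrt (b₁ ^ 2 + b₂ ^ 2 + b₃ ^ 2) := by
  set A := a₁ ^ 2 + a₂ ^ 2 + a₃ ^ 2 with hA
  set B := b₁ ^ 2 + b₂ ^ 2 + b₃ ^ 2 with hB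
  set C := a₁ * b₁ + a₂ * b₂ + a₃ * b₃ with hC
  have hA0 : 0 ≤ A := by positivity
  have hB0 : 0 ≤ B := by positivity
  have hCS : C ^ 2 ≤ A * B := by
    have h := Finset.sum_mul_sq_le_sq_mul_sq Finset.univ ![a₁, a₂, a₃] ![b₁, b₂, b₃]
    simpa [Fin.sum_univ_three, hA, hB] using h
  have hC : C ≤ Real.sqrt A * Real.sqrt B := by
    rw [← Real.sqrt_mul hA0]
    exact (le_abs_self C).trans (by rw [← Real.sqrt_sq_eq_abs]; exact Real.sqrt_le_sqrt hCS)
  have hexp : (a₁ + b₁) ^ 2 + (a₂ + b₂) ^ 2 + (a₃ + b₃) ^ 2 = A + B + 2 * C := by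
    simp only [hA, hB]; ring
  rw [hexp]
  have hle : A + B + 2 * C ≤ (Real.sqrt A + Real.sqrt B) ^ 2 := by
    rw [add_sq, Real.sq_sqrt hA0, Real.sq_sqrt hB0]
    nlinarith
  calc Real.sqrt (A + B + 2 * C) ≤ Real.sqrt ((Real.sqrt A + Real.sqrt B) ^ 2) :=
        Real.sqrt_le_sqrt hle
    _ = Real.sqrt A + Real.sqrt B := Real.sqrt_sq (by positivity)

/-! ### Minkowski: energies with square roots within `√defect` -/

/-- `(ENNReal.ofReal √r)² = ENNReal.ofReal r` for `r ≥ 0`, with the real exponent `2`. [folklore] -/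
theorem ofReal_sqrt_rpow_two {r : ℝ} (hr : 0 ≤ r) :
    ENNReal.ofReal (Real.sqrt r) ^ (2 : ℝ) = ENNReal.ofReal r := by
  rw [ENNReal.rpow_two, ← ENNReal.ofReal_pow (Real.sqrt_nonneg r), Real.sq_sqrt hr]

/-- **Abstract Minkowski step.** For nonnegative functions `e, d, p` on a measure space with
`√e ≤ √d + √p` pointwise and `√d, √p` a.e.-measurable,
`(∫ e)^{1/2} ≤ (∫ d)^{1/2} + (∫ p)^{1/2}` (lower Lebesgue integrals of `ofReal`). [folklore] -/
theorem lintegral_rpow_half_le_add {α : Type*} [MeasurableSpace α] {μ : Measure α}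
    {e d p : α → ℝ} (he : ∀ x, 0 ≤ e x) (hd : ∀ x, 0 ≤ d x) (hp : ∀ x, 0 ≤ p x)
    (htri : ∀ x, Real.sqrt (e x) ≤ Real.sqrt (d x) + Real.sqrt (p x))
    (hdm : AEMeasurable d μ) (hpm : AEMeasurable p μ) :
    (∫⁻ x, ENNReal.ofReal (e x) ∂μ) ^ (1 / 2 : ℝ) ≤
      (∫⁻ x, ENNReal.ofReal (d x) ∂μ) ^ (1 / 2 : ℝ) + (∫⁻ x, ENNReal.ofReal (p x) ∂μ) ^ (1 / 2 : ℝ) := by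
  set f : α → ℝ≥0∞ := fun x ↦ ENNReal.ofReal (Real.sqrt (d x)) with hf
  set g : α → ℝ≥0∞ := fun x ↦ ENNReal.ofReal (Real.sqrt (p x)) with hg
  have hfm : AEMeasurable f μ := (Real.continuous_sqrt.measurable.comp_aemeasurable hdm).ennreal_ofReal
  have hgm : AEMeasurable g μ := (Real.continuous_sqrt.measurable.comp_aemeasurable hpm).ennreal_ofReal
  have hM := ENNReal.lintegral_Lp_add_le hfm hgm (p := 2) (by norm_num)
  have hf2 : ∫⁻ x, f x ^ (2 : ℝ) ∂μ = ∫⁻ x, ENNReal.ofReal (d x) ∂μ :=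
    lintegral_congr fun x ↦ ofReal_sqrt_rpow_two (hd x)
  have hg2 : ∫⁻ x, g x ^ (2 : ℝ) ∂μ = ∫⁻ x, ENNReal.ofReal (p x) ∂μ :=
    lintegral_congr fun x ↦ ofReal_sqrt_rpow_two (hp x)
  rw [hf2, hg2] at hM
  refine le_trans ?_ hM
  refine ENNReal.rpow_le_rpow (lintegral_mono fun x ↦ ?_) (by norm_num)
  rw [← ofReal_sqrt_rpow_two (he x), Pi.add_apply]
  refine ENNReal.rpow_le_rpow ?_ (by norm_num)
  rw [hf, hg, ← ENNReal.ofReal_add (Real.sqrt_nonneg _) (Real.sqrt_nonneg _)]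
  exact ENNReal.ofReal_le_ofReal (htri x)

/-- **Abstract squeeze.** If `E^{1/2} ≤ D^{1/2} + P^{1/2}` and `P^{1/2} ≤ D^{1/2} + E^{1/2}`
eventually, `D → 0` and `P → L`, then `E → L` (in `ℝ≥0∞`). [folklore] -/
theorem tendsto_of_rpow_half_bounds {ι : Type*} {l : Filter ι} {E D P : ι → ℝ≥0∞} {L : ℝ≥0∞}
    (h₁ : ∀ᶠ i in l, E i ^ (1 / 2 : ℝ) ≤ D i ^ (1 / 2 : ℝ) + P i ^ (1 / 2 : ℝ))
    (h₂ : ∀ᶠ i in l, P i ^ (1 / 2 : ℝ) ≤ D i ^ (1 / 2 : ℝ) + E i ^ (1 / 2 : ℝ))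
    (hD : Tendsto D l (𝓝 0)) (hP : Tendsto P l (𝓝 L)) : Tendsto E l (𝓝 L) := by
  have hs : Continuous fun a : ℝ≥0∞ ↦ a ^ (1 / 2 : ℝ) := ENNReal.continuous_rpow_const
  have hD' : Tendsto (fun i ↦ D i ^ (1 / 2 : ℝ)) l (𝓝 0) := by
    have := (hs.tendsto 0).comp hD
    rwa [ENNReal.zero_rpow_of_pos (by norm_num : (0 : ℝ) < 1 / 2)] at this
  have hP' : Tendsto (fun i ↦ P i ^ (1 / 2 : ℝ)) l (𝓝 (L ^ (1 / 2 : ℝ))) := (hs.tendsto L).comp hP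
  have hup : Tendsto (fun i ↦ D i ^ (1 / 2 : ℝ) + P i ^ (1 / 2 : ℝ)) l (𝓝 (L ^ (1 / 2 : ℝ))) := by
    simpa using hD'.add hP'
  have hlow : Tendsto (fun i ↦ P i ^ (1 / 2 : ℝ) - D i ^ (1 / 2 : ℝ)) l (𝓝 (L ^ (1 / 2 : ℝ))) := by
    simpa using ENNReal.Tendsto.sub hP' hD' (Or.inr ENNReal.zero_ne_top)
  have hsq : Tendsto (fun i ↦ E i ^ (1 / 2 : ℝ)) l (𝓝 (L ^ (1 / 2 : ℝ))) :=
    tendsto_of_tendsto_of_tendsto_of_le_of_le' hlow hup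
      (h₂.mono fun i hi ↦ tsub_le_iff_right.2 (by simpa [add_comm] using hi)) h₁
  have hpow := ((ENNReal.continuous_pow 2).tendsto _).comp hsq
  have e2 : ∀ a : ℝ≥0∞, (a ^ (1 / 2 : ℝ)) ^ 2 = a := fun a ↦ by
    rw [one_div, show (2 : ℝ) = ((2 : ℕ) : ℝ) by norm_num]
    exact ENNReal.rpow_inv_natCast_pow two_ne_zero a
  simp only [Function.comp_def, e2] at hpow
  exact hpow

end Scattering1D

end Literature.Analysis.ODE
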